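import Mathlib
import Literature.Barriers.PneNP.TSPExtensionComplexityFarkas

/-!
# PneNP / ConvexRankGates — `ConvexGateBlind`: vertices of the certificate polytope of an LP gate

Helpers (`--supports stmt-PneNP-10680`) for the LP (diagonal) half of the crux. A monotone
LP-feasibility gate `x ↦ [∃ z ≥ 0 (q variables), ∀ i < p, ∑ⱼ Aᵢⱼ zⱼ ≤ rᵢ(x)]` rejects an input iff
some `y` in the **normalised certificate polytope**
`Π(A) = {y ∈ ℝ^p | y ≥ 0, yᵀA ≥ 0, ∑ yᵢ = 1}` has `y · r(x) < 0` (Farkas,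
`exists_mem_certPolytope_of_infeasible`), hence — `Π(A)` being a compact convex set — iff some
EXTREME POINT of `Π(A)` does (Krein–Milman, `exists_extremePoint_sum_mul_neg`). An extreme point
is pinned down by its support and its set of tight column constraints
(`eq_zero_of_mem_extremePoints_certPolytope`: no non-zero perturbation direction), its support has
at most `q + 1` elements (a rank count, `card_support_le_of_mem_extremePoints_certPolytope`), and
so `Π(A)` has at most `(p+1)^{q+1} · 2^q` extreme points
(`ncard_extremePoints_certPolytope_le`). Consequently an LP gate with `p` rows and `q` variables
is an AND of at most `(p+1)^{q+1} 2^q` non-negative threshold tests that are valid on its accepted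
inputs — exponential in the number of VARIABLES only; the sequel
`ConvexRankGatesConvexGateBlindFewVariables.lean` feeds this into the colouring count of
`ConvexRankGatesConvexGateBlindThresholds.lean`. [folklore: LP duality / basic solutions;
Schrijver, *Theory of Linear and Integer Programming*, §8]
-/

namespace Summit.PneNP.PneNP.Theorems

open Matrix Finset Filter Topology

/-! ### The normalised certificate polytope: convex and compact -/

/-- `Π(A)` is convex. [folklore] -/
theorem convex_certPolytope {p q : ℕ} (A : Fin p → Fin q → ℝ) :
    Convex ℝ {y : Fin p → ℝ | (∀ i, 0 ≤ y i) ∧ (∀ j, 0 ≤ ∑ i, y i * A i j) ∧ ∑ i, y i = 1} := by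
  intro y hy z hz a c ha hc hac
  obtain ⟨hy1, hy2, hy3⟩ := hy
  obtain ⟨hz1, hz2, hz3⟩ := hz
  refine ⟨fun i => ?_, fun j => ?_, ?_⟩
  · simp only [Pi.add_apply, Pi.smul_apply, smul_eq_mul]
    exact add_nonneg (mul_nonneg ha (hy1 i)) (mul_nonneg hc (hz1 i))
  · have h : ∑ i, (a • y + c • z) i * A i j = a * ∑ i, y i * A i j + c * ∑ i, z i * A i j := by
      simp only [Pi.add_apply, Pi.smul_apply, smul_eq_mul, Finset.mul_sum, ← Finset.sum_add_distrib]
      exact Finset.sum_congr rfl fun i _ => by ring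
    rw [h]
    exact add_nonneg (mul_nonneg ha (hy2 j)) (mul_nonneg hc (hz2 j))
  · have h : ∑ i, (a • y + c • z) i = a * ∑ i, y i + c * ∑ i, z i := by
      simp only [Pi.add_apply, Pi.smul_apply, smul_eq_mul, Finset.mul_sum, ← Finset.sum_add_distrib]
    rw [h, hy3, hz3, mul_one, mul_one, hac]

/-- `Π(A)` is compact (closed, and inside the unit cube). [folklore] -/
theorem isCompact_certPolytope {p q : ℕ} (A : Fin p → Fin q → ℝ) :
    IsCompact {y : Fin p → ℝ | (∀ i, 0 ≤ y i) ∧ (∀ j, 0 ≤ ∑ i, y i * A i j) ∧ ∑ i, y i = 1} := by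
  have hbox : IsCompact (Set.pi Set.univ fun _ : Fin p => Set.Icc (0 : ℝ) 1) :=
    isCompact_univ_pi fun _ => isCompact_Icc
  refine hbox.of_isClosed_subset ?_ ?_
  · have h1 : IsClosed {y : Fin p → ℝ | ∀ i, 0 ≤ y i} := by
      rw [Set.setOf_forall]
      exact isClosed_iInter fun i => isClosed_le continuous_const (continuous_apply i)
    have h2 : IsClosed {y : Fin p → ℝ | ∀ j, 0 ≤ ∑ i, y i * A i j} := by
      rw [Set.setOf_forall]
      exact isClosed_iInter fun j => isClosed_le continuous_const (by fun_prop)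
    have h3 : IsClosed {y : Fin p → ℝ | ∑ i, y i = 1} := isClosed_eq (by fun_prop) continuous_const
    simpa only [Set.setOf_and] using h1.inter (h2.inter h3)
  · rintro y ⟨hy1, -, hy3⟩
    simp only [Set.mem_pi, Set.mem_univ, Set.mem_Icc, forall_true_left]
    intro i
    refine ⟨hy1 i, ?_⟩
    calc y i ≤ ∑ i, y i := Finset.single_le_sum (fun i _ => hy1 i) (Finset.mem_univ i)
      _ = 1 := hy3

/-! ### Farkas: a rejected input has a normalised certificate -/

/-- **Farkas' lemma for a monotone LP-feasibility gate.** If `{z ≥ 0 | A z ≤ r}` is infeasible then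
some `y ∈ Π(A)` has `y · r < 0`. [folklore; from the conic Farkas lemma
`Literature.Barriers.PneNP.farkas` with generators the columns of `A` and the unit vectors] -/
theorem exists_mem_certPolytope_of_infeasible {p q : ℕ} (A : Fin p → Fin q → ℝ) (r : Fin p → ℝ)
    (hinf : ¬ ∃ z : Fin q → ℝ, (∀ j, 0 ≤ z j) ∧ ∀ i, ∑ j, A i j * z j ≤ r i) :
    ∃ y ∈ {y : Fin p → ℝ | (∀ i, 0 ≤ y i) ∧ (∀ j, 0 ≤ ∑ i, y i * A i j) ∧ ∑ i, y i = 1},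
      ∑ i, y i * r i < 0 := by
  classical
  let gen : Fin q ⊕ Fin p → Fin p → ℝ := Sum.elim (fun j i => A i j) (fun i' => Pi.single i' 1)
  rcases Literature.Barriers.PneNP.farkas gen r with ⟨lam, hlam, hr⟩ | ⟨y, hy, hyr⟩
  · exfalso
    apply hinf
    refine ⟨fun j => lam (Sum.inl j), fun j => hlam _, fun i => ?_⟩
    rw [hr i, Fintype.sum_sum_type]
    simp only [gen, Sum.elim_inl, Sum.elim_inr, Pi.single_apply, mul_ite, mul_one, mul_zero]
    rw [Finset.sum_ite_eq]
    simp only [Finset.mem_univ, if_true]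
    have h2 : ∑ j, A i j * lam (Sum.inl j) = ∑ j, lam (Sum.inl j) * A i j :=
      Finset.sum_congr rfl fun j _ => mul_comm _ _
    rw [h2]
    linarith [hlam (Sum.inr i)]
  · have hy0 : ∀ i, 0 ≤ y i := fun i => by
      have h := hy (Sum.inr i)
      simpa [gen, dotProduct, Pi.single_apply] using h
    have hcol : ∀ j, 0 ≤ ∑ i, y i * A i j := fun j => by
      have h := hy (Sum.inl j)
      simp only [gen, Sum.elim_inl, dotProduct] at h
      simpa [mul_comm] using h
    have hneg : ∑ i, y i * r i < 0 := by
      simp only [dotProduct] at hyr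
      simpa [mul_comm] using hyr
    have hS : 0 < ∑ i, y i := by
      by_contra hS
      have hS0 : ∑ i, y i = 0 := le_antisymm (not_lt.1 hS) (Finset.sum_nonneg fun i _ => hy0 i)
      have hy00 : ∀ i, y i = 0 := fun i =>
        (Finset.sum_eq_zero_iff_of_nonneg (fun i _ => hy0 i)).1 hS0 i (mem_univ i)
      have h0 : ∑ i, y i * r i = 0 := Finset.sum_eq_zero fun i _ => by rw [hy00 i, zero_mul]
      linarith
    refine ⟨fun i => y i / ∑ i, y i, ⟨fun i => div_nonneg (hy0 i) hS.le, fun j => ?_, ?_⟩, ?_⟩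
    · have h : ∑ i, y i / (∑ i, y i) * A i j = (∑ i, y i * A i j) / ∑ i, y i := by
        rw [Finset.sum_div]
        exact Finset.sum_congr rfl fun i _ => by ring
      rw [h]
      exact div_nonneg (hcol j) hS.le
    · rw [← Finset.sum_div, div_self hS.ne']
    · have h : ∑ i, y i / (∑ i, y i) * r i = (∑ i, y i * r i) / ∑ i, y i := by
        rw [Finset.sum_div]
        exact Finset.sum_congr rfl fun i _ => by ring
      rw [h]
      exact div_neg_of_neg_of_pos hneg hS

/-- **Weak duality.** Every `y ∈ Π(A)` (indeed every `y ≥ 0` with `yᵀA ≥ 0`) is non-negative on the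
right-hand side of a feasible system `{z ≥ 0 | A z ≤ r}`. [folklore] -/
theorem sum_mul_nonneg_of_feasible {p q : ℕ} (A : Fin p → Fin q → ℝ) {r y : Fin p → ℝ}
    (hy : ∀ i, 0 ≤ y i) (hyA : ∀ j, 0 ≤ ∑ i, y i * A i j)
    (hfeas : ∃ z : Fin q → ℝ, (∀ j, 0 ≤ z j) ∧ ∀ i, ∑ j, A i j * z j ≤ r i) :
    0 ≤ ∑ i, y i * r i := by
  obtain ⟨z, hz, hrows⟩ := hfeas
  calc (0 : ℝ) ≤ ∑ j, (∑ i, y i * A i j) * z j :=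
        Finset.sum_nonneg fun j _ => mul_nonneg (hyA j) (hz j)
    _ = ∑ i, y i * ∑ j, A i j * z j := by
        simp only [Finset.sum_mul, Finset.mul_sum]
        rw [Finset.sum_comm]
        exact Finset.sum_congr rfl fun i _ => Finset.sum_congr rfl fun j _ => by ring
    _ ≤ ∑ i, y i * r i := Finset.sum_le_sum fun i _ => mul_le_mul_of_nonneg_left (hrows i) (hy i)

/-! ### Krein–Milman: a rejecting certificate may be taken at a vertex -/

/-- A linear functional that is negative somewhere on a compact convex subset of `ℝ^p` is negative
at one of its extreme points (Krein–Milman: the set is the closed convex hull of its extreme points,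
and a closed half-space containing the extreme points contains that hull). [folklore] -/
theorem exists_extremePoint_sum_mul_neg {p : ℕ} {S : Set (Fin p → ℝ)} (hS : IsCompact S)
    (hconv : Convex ℝ S) (c : Fin p → ℝ) {y : Fin p → ℝ} (hy : y ∈ S)
    (hneg : ∑ i, y i * c i < 0) : ∃ v ∈ S.extremePoints ℝ, ∑ i, v i * c i < 0 := by
  by_contra hcon
  push Not at hcon
  have hH : IsClosed {z : Fin p → ℝ | 0 ≤ ∑ i, z i * c i} :=
    isClosed_le continuous_const (by fun_prop)
  have hHc : Convex ℝ {z : Fin p → ℝ | 0 ≤ ∑ i, z i * c i} := by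
    intro z hz w hw a b ha hb _
    simp only [Set.mem_setOf_eq, Pi.add_apply, Pi.smul_apply, smul_eq_mul] at hz hw ⊢
    have h : ∑ i, (a * z i + b * w i) * c i = a * ∑ i, z i * c i + b * ∑ i, w i * c i := by
      simp only [Finset.mul_sum, ← Finset.sum_add_distrib]
      exact Finset.sum_congr rfl fun i _ => by ring
    rw [h]
    exact add_nonneg (mul_nonneg ha hz) (mul_nonneg hb hw)
  have hsub : S ⊆ {z | 0 ≤ ∑ i, z i * c i} := by
    rw [← closure_convexHull_extremePoints hS hconv]
    exact closure_minimal (convexHull_min hcon hHc) hH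
  exact absurd (hsub hy) (not_le.2 hneg)

/-! ### Extreme points of `Π(A)` are pinned down by support and tight columns -/

/-- **Perturbation inside `Π(A)`.** If `d` vanishes off the support of `v ∈ Π(A)`, is orthogonal to
the columns of `A` that are tight at `v`, and has coordinate sum `0`, then `v ± ε d ∈ Π(A)` for some
`ε > 0` (finitely many strict inequalities stay strict under a small perturbation). [folklore] -/
theorem exists_perturb_mem_certPolytope {p q : ℕ} (A : Fin p → Fin q → ℝ) {v d : Fin p → ℝ}
    (hv : v ∈ {y : Fin p → ℝ | (∀ i, 0 ≤ y i) ∧ (∀ j, 0 ≤ ∑ i, y i * A i j) ∧ ∑ i, y i = 1})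
    (hd1 : ∀ i, v i = 0 → d i = 0) (hd2 : ∀ j, ∑ i, v i * A i j = 0 → ∑ i, d i * A i j = 0)
    (hd3 : ∑ i, d i = 0) :
    ∃ ε : ℝ, 0 < ε ∧
      (v + ε • d) ∈ {y : Fin p → ℝ | (∀ i, 0 ≤ y i) ∧ (∀ j, 0 ≤ ∑ i, y i * A i j) ∧ ∑ i, y i = 1} ∧
      (v - ε • d) ∈ {y : Fin p → ℝ | (∀ i, 0 ≤ y i) ∧ (∀ j, 0 ≤ ∑ i, y i * A i j) ∧ ∑ i, y i = 1} := by
  obtain ⟨hv1, hv2, hv3⟩ := hv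
  -- for `t` near `0`, `v + t • d ∈ Π(A)`
  have hev : ∀ᶠ t : ℝ in 𝓝 0, (v + t • d) ∈
      {y : Fin p → ℝ | (∀ i, 0 ≤ y i) ∧ (∀ j, 0 ≤ ∑ i, y i * A i j) ∧ ∑ i, y i = 1} := by
    have h1 : ∀ i, ∀ᶠ t : ℝ in 𝓝 0, 0 ≤ v i + t * d i := by
      intro i
      rcases (hv1 i).eq_or_lt with h | h
      · have hdi : d i = 0 := hd1 i h.symm
        exact Filter.Eventually.of_forall fun t => by rw [hdi, mul_zero, add_zero]; exact hv1 i
      · have ht : Tendsto (fun t : ℝ => v i + t * d i) (𝓝 0) (𝓝 (v i + 0 * d i)) :=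
          ((continuous_const.add (continuous_id.mul continuous_const)).tendsto 0)
        rw [zero_mul, add_zero] at ht
        exact (ht.eventually_const_lt h).mono fun t ht => ht.le
    have h2 : ∀ j, ∀ᶠ t : ℝ in 𝓝 0, 0 ≤ ∑ i, v i * A i j + t * ∑ i, d i * A i j := by
      intro j
      rcases (hv2 j).eq_or_lt with h | h
      · have hdj : ∑ i, d i * A i j = 0 := hd2 j h.symm
        exact Filter.Eventually.of_forall fun t => by rw [hdj, mul_zero, add_zero]; exact hv2 j
      · have ht : Tendsto (fun t : ℝ => ∑ i, v i * A i j + t * ∑ i, d i * A i j) (𝓝 0)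
            (𝓝 (∑ i, v i * A i j + 0 * ∑ i, d i * A i j)) :=
          ((continuous_const.add (continuous_id.mul continuous_const)).tendsto 0)
        rw [zero_mul, add_zero] at ht
        exact (ht.eventually_const_lt h).mono fun t ht => ht.le
    filter_upwards [Filter.eventually_all.2 h1, Filter.eventually_all.2 h2] with t ht1 ht2
    refine ⟨fun i => by simpa using ht1 i, fun j => ?_, ?_⟩
    · have h : ∑ i, (v + t • d) i * A i j = ∑ i, v i * A i j + t * ∑ i, d i * A i j := by
        simp only [Pi.add_apply, Pi.smul_apply, smul_eq_mul, Finset.mul_sum,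
          ← Finset.sum_add_distrib]
        exact Finset.sum_congr rfl fun i _ => by ring
      rw [h]
      exact ht2 j
    · have h : ∑ i, (v + t • d) i = ∑ i, v i + t * ∑ i, d i := by
        simp only [Pi.add_apply, Pi.smul_apply, smul_eq_mul, Finset.mul_sum,
          ← Finset.sum_add_distrib]
      rw [h, hv3, hd3, mul_zero, add_zero]
  -- the same for `-t`
  have hneg : Tendsto (fun t : ℝ => -t) (𝓝 0) (𝓝 0) := by
    simpa using (continuous_neg : Continuous fun t : ℝ => -t).tendsto 0
  have hev' := hneg.eventually hev
  obtain ⟨ε, hε, hall⟩ := Metric.eventually_nhds_iff.1 (hev.and hev')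
  have hdist : dist (ε / 2) 0 < ε := by
    rw [Real.dist_eq, sub_zero, abs_of_pos (half_pos hε)]
    exact half_lt_self hε
  obtain ⟨hplus, hminus⟩ := hall hdist
  refine ⟨ε / 2, half_pos hε, hplus, ?_⟩
  have h : v - (ε / 2) • d = v + (-(ε / 2)) • d := by rw [neg_smul, sub_eq_add_neg]
  rw [h]
  exact hminus

/-- **Extreme points admit no perturbation direction.** For an extreme point `v` of `Π(A)`, every
`d` vanishing off the support of `v`, orthogonal to the tight columns at `v` and with coordinate sum
`0` is `0` (otherwise `v` is the midpoint of `v ± ε d ∈ Π(A)`). [folklore] -/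
theorem eq_zero_of_mem_extremePoints_certPolytope {p q : ℕ} (A : Fin p → Fin q → ℝ)
    {v d : Fin p → ℝ}
    (hv : v ∈ {y : Fin p → ℝ | (∀ i, 0 ≤ y i) ∧ (∀ j, 0 ≤ ∑ i, y i * A i j) ∧
      ∑ i, y i = 1}.extremePoints ℝ)
    (hd1 : ∀ i, v i = 0 → d i = 0) (hd2 : ∀ j, ∑ i, v i * A i j = 0 → ∑ i, d i * A i j = 0)
    (hd3 : ∑ i, d i = 0) : d = 0 := by
  by_contra hd
  obtain ⟨ε, hε, hplus, hminus⟩ := exists_perturb_mem_certPolytope A hv.1 hd1 hd2 hd3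
  have hseg : v ∈ openSegment ℝ (v - ε • d) (v + ε • d) := by
    refine ⟨1 / 2, 1 / 2, by norm_num, by norm_num, by norm_num, ?_⟩
    ext i
    simp only [Pi.add_apply, Pi.smul_apply, Pi.sub_apply, smul_eq_mul]
    ring
  have h := hv.2 hminus hplus hseg
  have h' : ε • d = 0 := by
    have := congrArg (fun w => v - w) h
    simpa using this
  rcases smul_eq_zero.1 h' with h0 | h0
  · exact absurd h0 hε.ne'
  · exact hd h0

/-- Two extreme points of `Π(A)` with the same support and the same tight columns coincide. [folklore] -/
theorem eq_of_mem_extremePoints_certPolytope {p q : ℕ} (A : Fin p → Fin q → ℝ)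
    {v v' : Fin p → ℝ}
    (hv : v ∈ {y : Fin p → ℝ | (∀ i, 0 ≤ y i) ∧ (∀ j, 0 ≤ ∑ i, y i * A i j) ∧
      ∑ i, y i = 1}.extremePoints ℝ)
    (hv' : v' ∈ {y : Fin p → ℝ | (∀ i, 0 ≤ y i) ∧ (∀ j, 0 ≤ ∑ i, y i * A i j) ∧
      ∑ i, y i = 1}.extremePoints ℝ)
    (hsupp : ∀ i, v i = 0 ↔ v' i = 0)
    (htight : ∀ j, ∑ i, v i * A i j = 0 ↔ ∑ i, v' i * A i j = 0) : v = v' := by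
  have hd := eq_zero_of_mem_extremePoints_certPolytope A hv (d := v' - v)
    (fun i hi => by rw [Pi.sub_apply, hi, (hsupp i).1 hi, sub_zero])
    (fun j hj => by
      have h' := (htight j).1 hj
      have h : ∑ i, (v' - v) i * A i j = ∑ i, v' i * A i j - ∑ i, v i * A i j := by
        simp only [Pi.sub_apply, sub_mul, Finset.sum_sub_distrib]
      rw [h, hj, h', sub_zero])
    (by
      have h : ∑ i, (v' - v) i = ∑ i, v' i - ∑ i, v i := by
        simp only [Pi.sub_apply, Finset.sum_sub_distrib]
      rw [h, hv.1.2.2, hv'.1.2.2, sub_self])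
  exact (sub_eq_zero.1 hd).symm

/-- **Support bound.** An extreme point of `Π(A)` (`A` with `q` columns) has at most `q + 1` non-zero
coordinates: the map `d ↦ (d off the support, (d · A_j)_{j tight}, ∑ d)` is injective on `ℝ^p` by
`eq_zero_of_mem_extremePoints_certPolytope`, so `p ≤ (p - #support) + q + 1`. [folklore] -/
theorem card_support_le_of_mem_extremePoints_certPolytope {p q : ℕ} (A : Fin p → Fin q → ℝ)
    {v : Fin p → ℝ}
    (hv : v ∈ {y : Fin p → ℝ | (∀ i, 0 ≤ y i) ∧ (∀ j, 0 ≤ ∑ i, y i * A i j) ∧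
      ∑ i, y i = 1}.extremePoints ℝ) :
    (univ.filter fun i => v i ≠ 0).card ≤ q + 1 := by
  classical
  set S : Finset (Fin p) := univ.filter fun i => v i ≠ 0 with hS
  set T : Finset (Fin q) := univ.filter fun j => ∑ i, v i * A i j = 0 with hT
  let Ψ : (Fin p → ℝ) →ₗ[ℝ] (({i // i ∉ S} → ℝ) × (({j // j ∈ T} → ℝ) × ℝ)) :=
    { toFun := fun d => (fun i => d i.1, (fun j => ∑ i, d i * A i j.1, ∑ i, d i))
      map_add' := fun d d' => by
        ext <;> simp [add_mul, Finset.sum_add_distrib]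
      map_smul' := fun c d => by
        ext <;> simp [Finset.mul_sum, mul_assoc] }
  have hinj : Function.Injective Ψ := by
    rw [← LinearMap.ker_eq_bot, LinearMap.ker_eq_bot']
    intro d hd
    have hd' : (fun i : {i // i ∉ S} => d i.1) = 0 ∧ (fun j : {j // j ∈ T} => ∑ i, d i * A i j.1) = 0 ∧
        ∑ i, d i = 0 := by
      simpa [Ψ, Prod.ext_iff] using hd
    obtain ⟨h1, h2, h3⟩ := hd'
    refine eq_zero_of_mem_extremePoints_certPolytope A hv (fun i hi => ?_) (fun j hj => ?_) h3
    · have hi' : i ∉ S := by simp [hS, hi]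
      exact congr_fun h1 ⟨i, hi'⟩
    · have hj' : j ∈ T := by simp [hT, hj]
      exact congr_fun h2 ⟨j, hj'⟩
  have hrank := LinearMap.finrank_le_finrank_of_injective hinj
  rw [Module.finrank_fintype_fun_eq_card, Fintype.card_fin, Module.finrank_prod, Module.finrank_prod,
    Module.finrank_fintype_fun_eq_card, Module.finrank_fintype_fun_eq_card, Module.finrank_self,
    Fintype.card_subtype_compl, Fintype.card_fin] at hrank
  have hSc : Fintype.card {i // i ∈ S} = S.card := by simp
  have hTc : Fintype.card {j // j ∈ T} = T.card := by simp
  rw [hSc, hTc] at hrank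
  have hTq : T.card ≤ q := by
    calc T.card ≤ (univ : Finset (Fin q)).card := Finset.card_le_univ T
      _ = q := by simp
  have hSp : S.card ≤ p := by
    calc S.card ≤ (univ : Finset (Fin p)).card := Finset.card_le_univ S
      _ = p := by simp
  omega

/-! ### Counting the extreme points -/

/-- `∑_{s ≤ n} C(p, s) ≤ (p + 1)^n`. [folklore] -/
theorem sum_range_choose_le_pow (p n : ℕ) : ∑ s ∈ Finset.range (n + 1), p.choose s ≤ (p + 1) ^ n := by
  induction n with
  | zero => simp
  | succ n ih =>
    rw [Finset.sum_range_succ, pow_succ]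
    have h1 : p.choose (n + 1) ≤ p * (p + 1) ^ n := by
      calc p.choose (n + 1) ≤ p ^ (n + 1) := Nat.choose_le_pow p (n + 1)
        _ = p * p ^ n := by ring
        _ ≤ p * (p + 1) ^ n := Nat.mul_le_mul_left _ (Nat.pow_le_pow_left (by omega) _)
    calc ∑ s ∈ Finset.range (n + 1), p.choose s + p.choose (n + 1)
        ≤ (p + 1) ^ n + p * (p + 1) ^ n := Nat.add_le_add ih h1
      _ = (p + 1) ^ n * (p + 1) := by ring

/-- The subsets of `Fin p` of size at most `n` number at most `(p + 1)^n`. [folklore] -/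
theorem card_filter_card_le (p n : ℕ) :
    ((univ : Finset (Finset (Fin p))).filter fun S => S.card ≤ n).card ≤ (p + 1) ^ n := by
  classical
  have hsub : ((univ : Finset (Finset (Fin p))).filter fun S => S.card ≤ n) ⊆
      (Finset.range (n + 1)).biUnion fun s => Finset.powersetCard s (univ : Finset (Fin p)) := by
    intro S hS
    simp only [Finset.mem_filter, Finset.mem_univ, true_and] at hS
    simp only [Finset.mem_biUnion, Finset.mem_range, Finset.mem_powersetCard]
    exact ⟨S.card, by omega, Finset.subset_univ S, rfl⟩
  calc ((univ : Finset (Finset (Fin p))).filter fun S => S.card ≤ n).card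
      ≤ ((Finset.range (n + 1)).biUnion fun s => Finset.powersetCard s (univ : Finset (Fin p))).card :=
        Finset.card_le_card hsub
    _ ≤ ∑ s ∈ Finset.range (n + 1), (Finset.powersetCard s (univ : Finset (Fin p))).card :=
        Finset.card_biUnion_le
    _ = ∑ s ∈ Finset.range (n + 1), p.choose s := by
        refine Finset.sum_congr rfl fun s _ => ?_
        rw [Finset.card_powersetCard, Finset.card_univ, Fintype.card_fin]
    _ ≤ (p + 1) ^ n := sum_range_choose_le_pow p n

/-- **Vertex count.** `Π(A)` has finitely many extreme points, at most `(p+1)^{q+1} · 2^q` of them: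
an extreme point is determined by its support (of size `≤ q + 1`) and its set of tight columns.
[folklore] -/
theorem ncard_extremePoints_certPolytope_le {p q : ℕ} (A : Fin p → Fin q → ℝ) :
    ({y : Fin p → ℝ | (∀ i, 0 ≤ y i) ∧ (∀ j, 0 ≤ ∑ i, y i * A i j) ∧
        ∑ i, y i = 1}.extremePoints ℝ).Finite ∧
      ({y : Fin p → ℝ | (∀ i, 0 ≤ y i) ∧ (∀ j, 0 ≤ ∑ i, y i * A i j) ∧
        ∑ i, y i = 1}.extremePoints ℝ).ncard ≤ (p + 1) ^ (q + 1) * 2 ^ q := by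
  classical
  set E := {y : Fin p → ℝ | (∀ i, 0 ≤ y i) ∧ (∀ j, 0 ≤ ∑ i, y i * A i j) ∧
    ∑ i, y i = 1}.extremePoints ℝ with hE
  let code : (Fin p → ℝ) → Finset (Fin p) × Finset (Fin q) :=
    fun v => (univ.filter fun i => v i ≠ 0, univ.filter fun j => ∑ i, v i * A i j = 0)
  let F : Finset (Finset (Fin p) × Finset (Fin q)) :=
    ((univ : Finset (Finset (Fin p))).filter fun S => S.card ≤ q + 1) ×ˢ univ
  have hmaps : ∀ v ∈ E, code v ∈ (F : Set (Finset (Fin p) × Finset (Fin q))) := by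
    intro v hv
    simp only [Finset.coe_product, Finset.coe_filter, Finset.coe_univ, Set.mem_prod, Set.mem_setOf_eq,
      Finset.mem_univ, true_and, Set.mem_univ, and_true, code, F]
    exact card_support_le_of_mem_extremePoints_certPolytope A hv
  have hinj : Set.InjOn code E := by
    intro v hv v' hv' h
    simp only [code, Prod.mk.injEq] at h
    obtain ⟨h1, h2⟩ := h
    refine eq_of_mem_extremePoints_certPolytope A hv hv' (fun i => ?_) (fun j => ?_)
    · have := congrArg (fun s : Finset (Fin p) => i ∈ s) h1
      simp only [Finset.mem_filter, Finset.mem_univ, true_and, eq_iff_iff] at this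
      tauto
    · have := congrArg (fun s : Finset (Fin q) => j ∈ s) h2
      simp only [Finset.mem_filter, Finset.mem_univ, true_and, eq_iff_iff] at this
      exact this
  have hFfin : (F : Set (Finset (Fin p) × Finset (Fin q))).Finite := F.finite_toSet
  have hfin : E.Finite :=
    Set.Finite.of_finite_image (hFfin.subset (Set.image_subset_iff.2 hmaps)) hinj
  refine ⟨hfin, ?_⟩
  calc E.ncard ≤ (F : Set (Finset (Fin p) × Finset (Fin q))).ncard :=
        Set.ncard_le_ncard_of_injOn code hmaps hinj hFfin
    _ = F.card := Set.ncard_coe_finset F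
    _ = ((univ : Finset (Finset (Fin p))).filter fun S => S.card ≤ q + 1).card *
          (univ : Finset (Finset (Fin q))).card := Finset.card_product _ _
    _ ≤ (p + 1) ^ (q + 1) * 2 ^ q := by
        refine Nat.mul_le_mul (card_filter_card_le p (q + 1)) (le_of_eq ?_)
        rw [Finset.card_univ, Fintype.card_finset, Fintype.card_fin]

end Summit.PneNP.PneNP.Theorems
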